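import Summits.CriticalPhenomena.PercolationContinuityZ3.Theorems.PercNearOneGluingNoHeavyLowerTailSahiOneStepFibreF3CheckDefs
import Summits.CriticalPhenomena.PercolationContinuityZ3.Theorems.PercNearOneGluingNoHeavyLowerTailSahiOneStepFibreF3Reduce
import Mathlib.Algebra.Order.Ring.GeomSum
import Mathlib.Data.Real.Basic
import HarnessLib

/-!
# One-step scheme: COMPLETENESS of the enumeration of upper families (checker for the three-copy fibre forms, part 1)

Support file (prover prim-ineq-prove-3 gen 16; `--supports stmt-CriticalPhenomena-4575`; memo
`run/shared/lean/prim/prim-ineq-prove-3/FINDING-G16-FIBRE-MAJ5.md` §3.6, §3.8).  No definitions, no named facts, no sorries, no `native_decide`.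

* codes and masks (`…FibreF3CheckDefs`): `testBit_code`, `code_injective`, `testBit_maskOf` (bit `code S` of `maskOf U` is `[S ∈ U]`);
* **completeness** `maskOf_mem_upMasks`: the mask of every upper family of `P(range n)` is listed by `upMasks n` (induction on `n`: a family splits into
  its members avoiding `n` and the traces of its members containing `n`, both upper, the first contained in the second);
* **soundness** `checkSlow_sound`, `checkFive_sound`: if the checker accepts `(d1, d2, θ)` then `f3sum ℤ (range d1) (Ico d1 (d1+d2)) θ 1_U 1_V ≥ 0` for all
  masks `U, V` in `upMasks (d1+d2)` (`f3sum_indMask_eq`: the form of two mask indicators is the quadruple-data sum; `prog_eq`: the table evaluation of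
  the program is that sum; `maskSum_split` for the two-level enumeration of `checkFive`);
* `f3sum_upper_nonneg_nat_real`: hence, GIVEN the checks (run by `native_decide` in `…FibreF3CheckLeFour` / `…FibreF3CheckFiveD*`), the forms with
  `d1 + d2 ≤ 5` are `≥ 0` over `ℝ` on all pairs of upper families of `P(range (d1+d2))` (thresholds `0` and `> d1+d2` vanish identically).
-/

namespace Summit.CriticalPhenomena.PercolationContinuityZ3.Theorems

namespace SahiOneStep

open Finset

/-- Bit `i` of `code S` is `[i ∈ S]`. [folklore] -/
theorem testBit_code (S : Finset ℕ) (i : ℕ) : (code S).testBit i = decide (i ∈ S) := by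
  have h : i ∈ (code S).bitIndices ↔ i ∈ S := by
    rw [← List.mem_toFinset, code, Finset.toFinset_bitIndices_sum_two_pow]
  rw [Nat.mem_bitIndices] at h
  by_cases hi : i ∈ S
  · rw [decide_eq_true hi]; exact h.2 hi
  · rw [decide_eq_false hi]; exact Bool.eq_false_iff.2 fun h' => hi (h.1 h')

/-- Equal codes, equal finsets. [folklore] -/
theorem eq_of_code_eq {S T : Finset ℕ} (h : code S = code T) : S = T := by
  have := congrArg (fun n : ℕ => n.bitIndices.toFinset) h
  simpa only [code, Finset.toFinset_bitIndices_sum_two_pow] using this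

/-- Subsets of `range n` have code `< 2^n`. [folklore] -/
theorem code_lt_two_pow {S : Finset ℕ} {n : ℕ} (hS : S ⊆ Finset.range n) : code S < 2 ^ n :=
  Nat.geomSum_lt (le_refl 2) fun _ hk => Finset.mem_range.1 (hS hk)

/-- `code (insert n S) = 2^n + code S` for `n ∉ S`. [folklore] -/
theorem code_insert {S : Finset ℕ} {n : ℕ} (hn : n ∉ S) : code (insert n S) = 2 ^ n + code S := by
  rw [code, Finset.sum_insert hn, code]

/-- `maskOf U = code (U.image code)`. -/
theorem maskOf_eq_code_image (U : Finset (Finset ℕ)) : maskOf U = code (U.image code) := by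
  rw [maskOf, code, Finset.sum_image fun S _ T _ h => eq_of_code_eq h]

/-- Bit `code S` of `maskOf U` is `[S ∈ U]`. [folklore] -/
theorem testBit_maskOf (U : Finset (Finset ℕ)) (S : Finset ℕ) : (maskOf U).testBit (code S) = decide (S ∈ U) := by
  rw [maskOf_eq_code_image, testBit_code]
  by_cases h : S ∈ U
  · rw [decide_eq_true h, decide_eq_true (Finset.mem_image_of_mem code h)]
  · rw [decide_eq_false h, decide_eq_false]
    intro h'
    obtain ⟨T, hT, hTS⟩ := Finset.mem_image.1 h'
    exact h (eq_of_code_eq hTS ▸ hT)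

/-- Every set bit of `maskOf U` is the code of a member. [folklore] -/
theorem exists_of_testBit_maskOf {U : Finset (Finset ℕ)} {c : ℕ} (h : (maskOf U).testBit c = true) : ∃ S ∈ U, code S = c := by
  rw [maskOf_eq_code_image, testBit_code, decide_eq_true_eq, Finset.mem_image] at h
  exact h

/-- Masks of families of subsets of `range n` are `< 2^(2^n)`. [folklore] -/
theorem maskOf_lt {U : Finset (Finset ℕ)} {n : ℕ} (hU : U ⊆ (Finset.range n).powerset) : maskOf U < 2 ^ (2 ^ n) := by
  rw [maskOf_eq_code_image]
  refine code_lt_two_pow fun c hc => ?_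
  obtain ⟨S, hS, rfl⟩ := Finset.mem_image.1 hc
  exact Finset.mem_range.2 (code_lt_two_pow (Finset.mem_powerset.1 (hU hS)))

/-! ## Enumeration of the upper families of `P(range n)` -/

/-- Membership in `upMasks (n+1)`. -/
theorem mem_upMasks_succ {n m : ℕ} :
    m ∈ upMasks (n + 1) ↔ ∃ m₁ ∈ upMasks n, ∃ m₀ ∈ upMasks n, bitSubset (2 ^ n) m₀ m₁ = true ∧ m = m₀ + 2 ^ (2 ^ n) * m₁ := by
  simp only [upMasks, List.mem_flatMap, List.mem_map, List.mem_filter]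
  constructor
  · rintro ⟨m₁, hm₁, m₀, ⟨hm₀, hb⟩, rfl⟩
    exact ⟨m₁, hm₁, m₀, hm₀, hb, rfl⟩
  · rintro ⟨m₁, hm₁, m₀, hm₀, hb, rfl⟩
    exact ⟨m₁, hm₁, m₀, ⟨hm₀, hb⟩, rfl⟩

/-- Elements of `upMasks n` are `< 2^(2^n)`. -/
theorem lt_of_mem_upMasks : ∀ {n m : ℕ}, m ∈ upMasks n → m < 2 ^ (2 ^ n)
  | 0, m, h => by
    simp only [upMasks, List.mem_cons, List.not_mem_nil, or_false] at h
    rcases h with rfl | rfl <;> decide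
  | n + 1, m, h => by
    obtain ⟨m₁, hm₁, m₀, hm₀, -, rfl⟩ := mem_upMasks_succ.1 h
    have h0 := lt_of_mem_upMasks hm₀
    have h1 := lt_of_mem_upMasks hm₁
    have hpow : 2 ^ (2 ^ (n + 1)) = 2 ^ (2 ^ n) * 2 ^ (2 ^ n) := by rw [← pow_add, ← two_mul, ← pow_succ']
    rw [hpow]
    have h2 : m₀ + 2 ^ (2 ^ n) * m₁ < 2 ^ (2 ^ n) * (m₁ + 1) := by
      rw [mul_add, mul_one, add_comm]
      exact Nat.add_lt_add_left h0 _
    exact lt_of_lt_of_le h2 (Nat.mul_le_mul_left _ h1)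

/-- **Completeness of the enumeration**: the mask of every upper family of `P(range n)` is listed in `upMasks n`. [this work] -/
theorem maskOf_mem_upMasks : ∀ (n : ℕ) (U : Finset (Finset ℕ)), U ⊆ (Finset.range n).powerset →
    (∀ S ∈ U, ∀ T ∈ (Finset.range n).powerset, S ⊆ T → T ∈ U) → maskOf U ∈ upMasks n
  | 0, U, hUP, _ => by
    have hsub : U ⊆ {∅} := by simpa using hUP
    rcases Finset.subset_singleton_iff.1 hsub with rfl | rfl
    · simp [upMasks, maskOf]
    · simp [upMasks, maskOf, code]
  | n + 1, U, hUP, hUup => by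
    -- the two halves
    set U₀ := U.filter (fun S => n ∉ S) with hU₀
    set U₁ := (U.filter (fun S => n ∈ S)).image (fun S => S.erase n) with hU₁
    have hmemP : ∀ S ∈ U, S ⊆ Finset.range (n + 1) := fun S hS => Finset.mem_powerset.1 (hUP hS)
    have hU₀fam : U₀ ⊆ (Finset.range n).powerset ∧ ∀ S ∈ U₀, ∀ T ∈ (Finset.range n).powerset, S ⊆ T → T ∈ U₀ := by
      refine ⟨fun S hS => ?_, fun S hS T hT hST => ?_⟩
      · obtain ⟨hSU, hnS⟩ := Finset.mem_filter.1 hS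
        refine Finset.mem_powerset.2 fun i hi => ?_
        have := Finset.mem_range.1 (hmemP S hSU hi)
        exact Finset.mem_range.2 (lt_of_le_of_ne (Nat.lt_succ_iff.1 this) fun h => hnS (h ▸ hi))
      · obtain ⟨hSU, _⟩ := Finset.mem_filter.1 hS
        have hTr : T ⊆ Finset.range n := Finset.mem_powerset.1 hT
        refine Finset.mem_filter.2 ⟨hUup S hSU T (Finset.mem_powerset.2 (hTr.trans ?_)) hST, fun hnT => ?_⟩
        · exact Finset.range_subset_range.2 (Nat.le_succ n)
        · exact absurd (Finset.mem_range.1 (hTr hnT)) (lt_irrefl n)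
    have hU₁fam : U₁ ⊆ (Finset.range n).powerset ∧ ∀ S ∈ U₁, ∀ T ∈ (Finset.range n).powerset, S ⊆ T → T ∈ U₁ := by
      refine ⟨fun S hS => ?_, fun S hS T hT hST => ?_⟩
      · obtain ⟨S', hS', rfl⟩ := Finset.mem_image.1 hS
        obtain ⟨hS'U, _⟩ := Finset.mem_filter.1 hS'
        refine Finset.mem_powerset.2 fun i hi => ?_
        obtain ⟨hin, hiS'⟩ := Finset.mem_erase.1 hi
        have := Finset.mem_range.1 (hmemP S' hS'U hiS')
        exact Finset.mem_range.2 (lt_of_le_of_ne (Nat.lt_succ_iff.1 this) hin)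
      · obtain ⟨S', hS', rfl⟩ := Finset.mem_image.1 hS
        obtain ⟨hS'U, hnS'⟩ := Finset.mem_filter.1 hS'
        have hTr : T ⊆ Finset.range n := Finset.mem_powerset.1 hT
        have hnT : n ∉ T := fun h => absurd (Finset.mem_range.1 (hTr h)) (lt_irrefl n)
        have hins : insert n T ∈ U := by
          refine hUup S' hS'U (insert n T) (Finset.mem_powerset.2 ?_) ?_
          · rw [Finset.insert_subset_iff]
            exact ⟨Finset.mem_range.2 (Nat.lt_succ_self n), hTr.trans (Finset.range_subset_range.2 (Nat.le_succ n))⟩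
          · intro i hi
            by_cases hin : i = n
            · exact hin ▸ Finset.mem_insert_self n T
            · exact Finset.mem_insert_of_mem (hST (Finset.mem_erase.2 ⟨hin, hi⟩))
        refine Finset.mem_image.2 ⟨insert n T, Finset.mem_filter.2 ⟨hins, Finset.mem_insert_self n T⟩, ?_⟩
        rw [Finset.erase_insert hnT]
    have ih₀ := maskOf_mem_upMasks n U₀ hU₀fam.1 hU₀fam.2
    have ih₁ := maskOf_mem_upMasks n U₁ hU₁fam.1 hU₁fam.2
    -- the subset relation between the halves
    have hsub : bitSubset (2 ^ n) (maskOf U₀) (maskOf U₁) = true := by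
      simp only [bitSubset, List.all_eq_true, Bool.or_eq_true, Bool.not_eq_true']
      intro c _
      by_cases hc : (maskOf U₀).testBit c = true
      · right
        obtain ⟨S, hS, rfl⟩ := exists_of_testBit_maskOf hc
        rw [testBit_maskOf, decide_eq_true_eq]
        obtain ⟨hSU, hnS⟩ := Finset.mem_filter.1 hS
        have hSr : S ⊆ Finset.range n := Finset.mem_powerset.1 (hU₀fam.1 hS)
        have hins : insert n S ∈ U := by
          refine hUup S hSU (insert n S) (Finset.mem_powerset.2 ?_) (Finset.subset_insert n S)
          rw [Finset.insert_subset_iff]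
          exact ⟨Finset.mem_range.2 (Nat.lt_succ_self n), hSr.trans (Finset.range_subset_range.2 (Nat.le_succ n))⟩
        refine Finset.mem_image.2 ⟨insert n S, Finset.mem_filter.2 ⟨hins, Finset.mem_insert_self n S⟩, ?_⟩
        rw [Finset.erase_insert hnS]
      · left; simpa using hc
    -- the mask splits
    have hsplit : maskOf U = maskOf U₀ + 2 ^ (2 ^ n) * maskOf U₁ := by
      have h1 : maskOf U = ∑ S ∈ U.filter (fun S => n ∉ S), 2 ^ code S + ∑ S ∈ U.filter (fun S => n ∈ S), 2 ^ code S := by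
        rw [maskOf, ← Finset.sum_filter_add_sum_filter_not U (fun S => n ∉ S)]
        simp only [not_not]
      have h2 : ∑ S ∈ U.filter (fun S => n ∈ S), 2 ^ code S = 2 ^ (2 ^ n) * maskOf U₁ := by
        rw [hU₁, maskOf, Finset.sum_image]
        · rw [Finset.mul_sum]
          refine Finset.sum_congr rfl fun S hS => ?_
          obtain ⟨_, hnS⟩ := Finset.mem_filter.1 hS
          conv_lhs => rw [← Finset.insert_erase hnS]
          rw [code_insert (Finset.notMem_erase n S), pow_add]
        · intro S hS T hT h
          obtain ⟨_, hnS⟩ := Finset.mem_filter.1 hS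
          obtain ⟨_, hnT⟩ := Finset.mem_filter.1 hT
          simp only at h
          rw [← Finset.insert_erase hnS, ← Finset.insert_erase hnT, h]
      rw [h1, h2]
      rfl
    rw [hsplit]
    exact mem_upMasks_succ.2 ⟨maskOf U₁, ih₁, maskOf U₀, ih₀, hsub, rfl⟩

end SahiOneStep

end Summit.CriticalPhenomena.PercolationContinuityZ3.Theorems
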